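import Mathlib
import HarnessLib
import Summits.PneNP.PneNP.Theorems.CnfIdealGenLengthRankDefectRepresentationsPhantomTransfer
import Summits.PneNP.PneNP.Theorems.CnfIdealGenLengthRankDefectRepresentationsTheoryToCnf
import Summits.PneNP.PneNP.Theorems.CnfIdealGenLengthRankDefectRepresentationsDiagonal

/-!
# Crux `RankDefectRepresentations` (stmt-PneNP-18923), line `phantom-kernel`: CLOSED MODULO S1

With the tool stubs S2 (`stub_theoryToCnf`, p579667) and S3 (`stub_diagonal`, p579615) landed, the transfer of the
line is unconditional: CONTRADICTORY PHANTOMS (the registered hard stub S1 `stub_contradictoryPhantoms`, unfolded)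
imply the crux `Summit.PneNP.PneNP.Theses.CnfIdealGenLength.RankDefectRepresentations`
(`rankDefectRepresentations_of_contradictoryPhantoms`), and polynomial rank-stability of the Boolean/commutator
presentation refutes S1 (`not_contradictoryPhantoms_of_polyStable`, the kill path through p542939).  What remains
of the crux along this line is exactly S1 — an almost-representation of the `n`-cube in characteristic `0` with
axiom defects of rank `≤ t` and a subspace of dimension `> n^c · t` on which a contradictory set of clause words of
bounded length vanishes — which is crux-sized: by the in-tree Frege ceiling any proof is a superpolynomial Frege
lower bound.  HONEST FRAMING: P ≠ NP is not moved; F-N2 is a FRONTIER formal rung.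
-/

set_option linter.dupNamespace false -- `Summit.PneNP.PneNP.…`: summit = sub-problem name (D-0017)

namespace Summit.PneNP.PneNP.Theorems.CnfIdealGenLength

open Filter
open Literature.Computability.Complexity
open Literature.Computability.MetaComplexity
open Literature.Computability.MetaComplexity.NCIPS

/-- **The line `phantom-kernel`, closed modulo its hard stub.** Contradictory phantoms (S1, unfolded) imply
`RankDefectRepresentations`. [folklore] -/
theorem rankDefectRepresentations_of_contradictoryPhantoms
    (hS1 : ∃ w : ℕ, ∀ c : ℕ, ∀ᶠ n : ℕ in atTop, ∃ (K : Type) (_ : Field K) (_ : CharZero K) (d t : ℕ)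
      (M : Fin n → Matrix (Fin d) (Fin d) K) (U : Submodule K (Fin d → K)),
      (∀ g : MonoidAlgebra K (FreeMonoid (Fin n)), IsAxiom g →
        (MonoidAlgebra.lift K (Matrix (Fin d) (Fin d) K) (FreeMonoid (Fin n)) (FreeMonoid.lift M) g).rank
          ≤ t) ∧
      n ^ c * t < Module.finrank K U ∧
      ∀ σ : Fin n → Bool, ∃ κ : Clause (Fin n), κ.length ≤ w ∧
        (∀ u ∈ U, (MonoidAlgebra.lift K (Matrix (Fin d) (Fin d) K) (FreeMonoid (Fin n))
          (FreeMonoid.lift M) (clauseWord K κ)).mulVec u = 0) ∧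
        Clause.eval σ κ = false) :
    Summit.PneNP.PneNP.Theses.CnfIdealGenLength.RankDefectRepresentations :=
  rankDefectRepresentations_of_contradictoryPhantoms_of_tools
    CnfIdealGenLengthRankDefectRepresentationsTheoryToCnf.stub_theoryToCnf
    CnfIdealGenLengthRankDefectRepresentationsDiagonal.stub_diagonal hS1

/-- **Kill path of the line.** Polynomial rank-stability of the Boolean/commutator presentation (hypothesis shape
`hST` of `not_rankDefectRepresentations_of_polyStable`) refutes contradictory phantoms (S1). [folklore] -/
theorem not_contradictoryPhantoms_of_polyStable
    (hST : ∃ a : ℕ, ∀ᶠ n : ℕ in atTop, ∀ (K : Type) [Field K] [CharZero K] (d t : ℕ)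
      (M : Fin n → Matrix (Fin d) (Fin d) K),
      (∀ g : MonoidAlgebra K (FreeMonoid (Fin n)), IsAxiom g →
        (MonoidAlgebra.lift K (Matrix (Fin d) (Fin d) K) (FreeMonoid (Fin n)) (FreeMonoid.lift M) g).rank ≤ t) →
      ∃ M' : Fin n → Matrix (Fin d) (Fin d) K, (∀ i, M' i * M' i = M' i) ∧ (∀ i j, M' i * M' j = M' j * M' i) ∧
        ∀ i, (M i - M' i).rank ≤ n ^ a * t) :
    ¬ ∃ w : ℕ, ∀ c : ℕ, ∀ᶠ n : ℕ in atTop, ∃ (K : Type) (_ : Field K) (_ : CharZero K) (d t : ℕ)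
      (M : Fin n → Matrix (Fin d) (Fin d) K) (U : Submodule K (Fin d → K)),
      (∀ g : MonoidAlgebra K (FreeMonoid (Fin n)), IsAxiom g →
        (MonoidAlgebra.lift K (Matrix (Fin d) (Fin d) K) (FreeMonoid (Fin n)) (FreeMonoid.lift M) g).rank
          ≤ t) ∧
      n ^ c * t < Module.finrank K U ∧
      ∀ σ : Fin n → Bool, ∃ κ : Clause (Fin n), κ.length ≤ w ∧
        (∀ u ∈ U, (MonoidAlgebra.lift K (Matrix (Fin d) (Fin d) K) (FreeMonoid (Fin n))
          (FreeMonoid.lift M) (clauseWord K κ)).mulVec u = 0) ∧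
        Clause.eval σ κ = false := fun hS1 =>
  not_rankDefectRepresentations_of_polyStable hST (rankDefectRepresentations_of_contradictoryPhantoms hS1)

end Summit.PneNP.PneNP.Theorems.CnfIdealGenLength
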